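import Summits.NavierStokesRegularity.NavierStokesRegularity.Theorems.EfficiencyFloorNearSaturationNearMaximiserSeqCoreTools
import HarnessLib

/-!
# Route `EfficiencyFloor`, crux `NearSaturationNearMaximiser` (stmt-NavierStokesRegularity-25482): TRANSPORT steps of the
# sequential core — normalisation to `Z = Pal = 1`, closeness under the amplitude correction, closeness transported back

Helper file (`--supports stmt-NavierStokesRegularity-25482`), the three bookkeeping steps of `shape_of_seqCore`
(`…NearSaturationNearMaximiserSeqCore`) isolated as lemmas over the tools of `…SeqCoreTools` (p840717):

* `normalise` — for an admissible `v` with `Z, Pal > 0`, `A = Z^{1/4}`, `B = Pal^{1/4}`, the field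
  `T v = (x ↦ (A²/B²) • ((B/A³) • v ((A²/B²) • x)))` has `Z = Pal = 1` and `S(T v) = S(v)/(A³B³)`;
* `close_of_amplitude` — if `m` (`Z = Pal = 1`) is `ε/2`-close to `v'` and `|r − 1| ≤ δ ≤ ε/2`, then `r • m` is `ε`-close;
* `transport_close` — closeness `Z(T_{l,b}v − m̃) ≤ ε²·Z(T_{l,b}v)`-type bounds pull back along the inverse transport:
  `Z(v − T_{l,b}⁻¹ m̃) ≤ ε²·Z(v)`, same for `Pal`, when `Z(T_{l,b} v − m̃) ≤ ε²` and `Z(T_{l,b}v) = 1` (resp. `Pal`).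

HONEST FRAMING: elementary bookkeeping; nothing about stmt-25482 or Navier–Stokes regularity is decided; no summit statement is
proved. [folklore]
-/

-- the problem directory repeats the summit name (`NavierStokesRegularity/NavierStokesRegularity`)
set_option linter.dupNamespace false

noncomputable section

namespace Summit.NavierStokesRegularity.NavierStokesRegularity.Theorems

namespace NearSaturationNearMaximiser

namespace SeqCore

open Set MeasureTheory Filter Topology Function
open scoped InnerProductSpace ENNReal
open Literature.Analysis.FluidPDE
open RigidExit.ReferenceShadowing

/-- **Normalisation.** For an admissible `v` with `Z(v), Pal(v) > 0`, `A = Z^{1/4}`, `B = Pal^{1/4}`, `l = A²/B²`, `b = B/A³`: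
the transported field `x ↦ l • (b • v (l • x))` has `Z = 1`, `Pal = 1` and stretching `S(v)/(A³B³)`. [folklore] -/
theorem normalise {v : EuclideanSpace ℝ (Fin 3) → EuclideanSpace ℝ (Fin 3)}
    (hv : ContDiff ℝ (⊤ : ℕ∞) v ∧ VectorCalculus.IsDivFree v ∧ (∫⁻ x, ‖iteratedFDeriv ℝ 0 v x‖ₑ ^ 2 < ⊤) ∧
      (∫⁻ x, ‖iteratedFDeriv ℝ 1 v x‖ₑ ^ 2 < ⊤) ∧ (∫⁻ x, ‖iteratedFDeriv ℝ 2 v x‖ₑ ^ 2 < ⊤))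
    {A B : ℝ} (hA : 0 < A) (hB : 0 < B) (hA4 : A ^ 4 = ∫ x, ‖curl v x‖ ^ 2)
    (hB4 : B ^ 4 = ∫ x, frobeniusNormSq (fderiv ℝ (curl v) x)) :
    (∫ x, ‖curl (fun x => (A ^ 2 / B ^ 2) • ((B / A ^ 3) • v ((A ^ 2 / B ^ 2) • x))) x‖ ^ 2) = 1 ∧
    (∫ x, frobeniusNormSq (fderiv ℝ (curl (fun x => (A ^ 2 / B ^ 2) • ((B / A ^ 3) • v ((A ^ 2 / B ^ 2) • x)))) x)) = 1 ∧
    (∫ x, ⟪curl (fun x => (A ^ 2 / B ^ 2) • ((B / A ^ 3) • v ((A ^ 2 / B ^ 2) • x))) x,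
        fderiv ℝ (fun x => (A ^ 2 / B ^ 2) • ((B / A ^ 3) • v ((A ^ 2 / B ^ 2) • x))) x
          (curl (fun x => (A ^ 2 / B ^ 2) • ((B / A ^ 3) • v ((A ^ 2 / B ^ 2) • x))) x)⟫_ℝ) =
      (∫ x, ⟪curl v x, fderiv ℝ v x (curl v x)⟫_ℝ) / (A ^ 3 * B ^ 3) := by
  have hl : 0 < A ^ 2 / B ^ 2 := by positivity
  have hdiff : Differentiable ℝ v := hv.1.differentiable (by simp)
  have hC2 : ContDiff ℝ 2 v := hv.1.of_le (by norm_cast)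
  have hA0 : A ≠ 0 := hA.ne'
  have hB0 : B ≠ 0 := hB.ne'
  refine ⟨?_, ?_, ?_⟩
  · rw [enstrophy_transport hdiff hl, ← hA4]
    field_simp
  · rw [palinstrophy_transport hC2 hl, ← hB4]
    field_simp
  · rw [stretching_transport hdiff hl]
    field_simp

/-- **Closeness survives the amplitude correction.** If `m` (smooth, `D¹, D² ∈ L²`, `Z(m) = Pal(m) = 1`) satisfies
`Z(v' − m), Pal(v' − m) ≤ (ε/2)²` and `|r − 1| ≤ δ ≤ ε/2`, then `Z(v' − r•m) ≤ ε²` and `Pal(v' − r•m) ≤ ε²`. [folklore] -/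
theorem close_of_amplitude {v' m : EuclideanSpace ℝ (Fin 3) → EuclideanSpace ℝ (Fin 3)}
    (hv' : ContDiff ℝ (⊤ : ℕ∞) v' ∧ VectorCalculus.IsDivFree v' ∧ (∫⁻ x, ‖iteratedFDeriv ℝ 0 v' x‖ₑ ^ 2 < ⊤) ∧
      (∫⁻ x, ‖iteratedFDeriv ℝ 1 v' x‖ₑ ^ 2 < ⊤) ∧ (∫⁻ x, ‖iteratedFDeriv ℝ 2 v' x‖ₑ ^ 2 < ⊤))
    (hm : ContDiff ℝ (⊤ : ℕ∞) m ∧ VectorCalculus.IsDivFree m ∧ (∫⁻ x, ‖iteratedFDeriv ℝ 0 m x‖ₑ ^ 2 < ⊤) ∧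
      (∫⁻ x, ‖iteratedFDeriv ℝ 1 m x‖ₑ ^ 2 < ⊤) ∧ (∫⁻ x, ‖iteratedFDeriv ℝ 2 m x‖ₑ ^ 2 < ⊤))
    (hZm : (∫ x, ‖curl m x‖ ^ 2) = 1) (hPm : (∫ x, frobeniusNormSq (fderiv ℝ (curl m) x)) = 1)
    {ε δ r : ℝ} (hε : 0 < ε) (hδε : δ ≤ ε / 2) (hr1 : |r - 1| ≤ δ)
    (hZc : (∫ x, ‖curl (v' - m) x‖ ^ 2) ≤ (ε / 2) ^ 2)
    (hPc : (∫ x, frobeniusNormSq (fderiv ℝ (curl (v' - m)) x)) ≤ (ε / 2) ^ 2) :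
    (∫ x, ‖curl (v' - fun y => r • m y) x‖ ^ 2) ≤ ε ^ 2 ∧
      (∫ x, frobeniusNormSq (fderiv ℝ (curl (v' - fun y => r • m y)) x)) ≤ ε ^ 2 := by
  have hmrAdm := admissible_const_smul hm r
  have hmdiff : Differentiable ℝ m := hm.1.differentiable (by simp)
  have hfcd : ContDiff ℝ (⊤ : ℕ∞) (v' - fun y => r • m y) := hv'.1.sub hmrAdm.1
  have hwcd : ContDiff ℝ (⊤ : ℕ∞) (v' - m) := hv'.1.sub hm.1
  have hf1 := lintegral_iteratedFDeriv_sub_lt_top hv'.1 hmrAdm.1 1 hv'.2.2.2.1 hmrAdm.2.2.2.1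
  have hw1 := lintegral_iteratedFDeriv_sub_lt_top hv'.1 hm.1 1 hv'.2.2.2.1 hm.2.2.2.1
  have hw2 := lintegral_iteratedFDeriv_sub_lt_top hv'.1 hm.1 2 hv'.2.2.2.2 hm.2.2.2.2
  have hδ0 : 0 ≤ δ := (abs_nonneg _).trans hr1
  constructor
  · have htri := sqrt_enstrophy_sub_le hfcd hf1 hwcd hw1
    have hfw : ((v' - fun y => r • m y) - (v' - m)) = fun y => (1 - r) • m y := by
      funext y
      simp only [Pi.sub_apply, sub_smul, one_smul]
      abel
    rw [hfw, enstrophy_const_smul hmdiff, hZm, mul_one, Real.sqrt_sq_eq_abs] at htri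
    have h1 : Real.sqrt (∫ x, ‖curl (v' - m) x‖ ^ 2) ≤ ε / 2 := by
      rw [show ε / 2 = Real.sqrt ((ε / 2) ^ 2) by rw [Real.sqrt_sq (by positivity)]]
      exact Real.sqrt_le_sqrt hZc
    have h2 : Real.sqrt (∫ x, ‖curl (v' - fun y => r • m y) x‖ ^ 2) ≤ ε := by
      have h3 := (abs_sub_le_iff.1 htri).1
      rw [abs_sub_comm] at hr1
      linarith
    have h0 : 0 ≤ ∫ x, ‖curl (v' - fun y => r • m y) x‖ ^ 2 := integral_nonneg fun x => by positivity
    calc (∫ x, ‖curl (v' - fun y => r • m y) x‖ ^ 2)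
        = (Real.sqrt (∫ x, ‖curl (v' - fun y => r • m y) x‖ ^ 2)) ^ 2 := (Real.sq_sqrt h0).symm
      _ ≤ ε ^ 2 := pow_le_pow_left₀ (Real.sqrt_nonneg _) h2 2
  · have hgcd : ContDiff ℝ (⊤ : ℕ∞) ((fun y => r • m y) - m) := hmrAdm.1.sub hm.1
    have hg2 := lintegral_iteratedFDeriv_sub_lt_top hmrAdm.1 hm.1 2 hmrAdm.2.2.2.2 hm.2.2.2.2
    have h := palinstrophy_sub_le hwcd hgcd hw2 hg2
    have hfg : (v' - m) - ((fun y => r • m y) - m) = v' - fun y => r • m y := sub_sub_sub_cancel_right _ _ _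
    rw [hfg] at h
    have hmm : ((fun y => r • m y) - m) = fun y => (r - 1) • m y := by
      funext y
      simp only [Pi.sub_apply, sub_smul, one_smul]
    rw [hmm, palinstrophy_const_smul (hm.1.of_le (by norm_cast)), hPm, mul_one] at h
    have hr2 : (r - 1) ^ 2 ≤ δ ^ 2 := by
      rw [← sq_abs]
      exact pow_le_pow_left₀ (abs_nonneg _) hr1 2
    have hδ2 : δ ^ 2 ≤ (ε / 2) ^ 2 := pow_le_pow_left₀ hδ0 hδε 2
    have h4 : (ε / 2) ^ 2 = ε ^ 2 / 4 := by ring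
    linarith [hPc]

/-- **Closeness pulls back along the inverse transport.** With `T v = (x ↦ l•(b•v(l•x)))` (`l, b > 0`) normalised to
`Z(T v) = 1`, `Pal(T v) = 1`: if `Z(T v − m̃) ≤ ε²` and `Pal(T v − m̃) ≤ ε²` then the pulled-back field
`m = (x ↦ l⁻¹•(b⁻¹•m̃(l⁻¹•x)))` satisfies `Z(v − m) ≤ ε²·Z(v)` and `Pal(v − m) ≤ ε²·Pal(v)`. [folklore] -/
theorem transport_close {v m' : EuclideanSpace ℝ (Fin 3) → EuclideanSpace ℝ (Fin 3)} (hv : ContDiff ℝ (⊤ : ℕ∞) v)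
    (hm' : ContDiff ℝ (⊤ : ℕ∞) m') {l b ε : ℝ} (hl : 0 < l) (hb : 0 < b)
    (hZ1 : (∫ x, ‖curl (fun x => l • (b • v (l • x))) x‖ ^ 2) = 1)
    (hP1 : (∫ x, frobeniusNormSq (fderiv ℝ (curl (fun x => l • (b • v (l • x)))) x)) = 1)
    (hZc : (∫ x, ‖curl ((fun x => l • (b • v (l • x))) - m') x‖ ^ 2) ≤ ε ^ 2)
    (hPc : (∫ x, frobeniusNormSq (fderiv ℝ (curl ((fun x => l • (b • v (l • x))) - m')) x)) ≤ ε ^ 2) :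
    (∫ x, ‖curl (v - fun x => l⁻¹ • (b⁻¹ • m' (l⁻¹ • x))) x‖ ^ 2) ≤ ε ^ 2 * ∫ x, ‖curl v x‖ ^ 2 ∧
      (∫ x, frobeniusNormSq (fderiv ℝ (curl (v - fun x => l⁻¹ • (b⁻¹ • m' (l⁻¹ • x)))) x)) ≤
        ε ^ 2 * ∫ x, frobeniusNormSq (fderiv ℝ (curl v) x) := by
  have hl0 : l ≠ 0 := hl.ne'
  have hb0 : b ≠ 0 := hb.ne'
  have hTcd : ContDiff ℝ (⊤ : ℕ∞) (fun x => l • (b • v (l • x))) :=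
    ((hv.comp (contDiff_const_smul l)).const_smul b).const_smul l
  have hfcd : ContDiff ℝ (⊤ : ℕ∞) ((fun x => l • (b • v (l • x))) - m') := hTcd.sub hm'
  have hsub : (v - fun x => l⁻¹ • (b⁻¹ • m' (l⁻¹ • x))) =
      fun x => l⁻¹ • (b⁻¹ • ((fun x => l • (b • v (l • x))) - m') (l⁻¹ • x)) := by
    calc (v - fun x => l⁻¹ • (b⁻¹ • m' (l⁻¹ • x)))
        = (fun x => l⁻¹ • (b⁻¹ • (fun y => l • (b • v (l • y))) (l⁻¹ • x))) - fun x => l⁻¹ • (b⁻¹ • m' (l⁻¹ • x)) := by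
          rw [transport_inv v hl0 hb0]
      _ = _ := transport_sub (fun y => l • (b • v (l • y))) m' l⁻¹ b⁻¹
  have hZv : (∫ x, ‖curl v x‖ ^ 2) = l⁻¹ * b⁻¹ ^ 2 * ∫ x, ‖curl (fun x => l • (b • v (l • x))) x‖ ^ 2 := by
    have h := enstrophy_transport (hTcd.differentiable (by simp)) (inv_pos.2 hl) b⁻¹
    rw [transport_inv v hl0 hb0] at h
    exact h
  have hPv : (∫ x, frobeniusNormSq (fderiv ℝ (curl v) x)) =
      l⁻¹ ^ 3 * b⁻¹ ^ 2 * ∫ x, frobeniusNormSq (fderiv ℝ (curl (fun x => l • (b • v (l • x)))) x) := by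
    have h := palinstrophy_transport (hTcd.of_le (by norm_cast)) (inv_pos.2 hl) b⁻¹
    rw [transport_inv v hl0 hb0] at h
    exact h
  have hcoefZ : 0 ≤ l⁻¹ * b⁻¹ ^ 2 := by positivity
  have hcoefP : 0 ≤ l⁻¹ ^ 3 * b⁻¹ ^ 2 := by positivity
  constructor
  · rw [hsub, enstrophy_transport (hfcd.differentiable (by simp)) (inv_pos.2 hl) b⁻¹, hZv, hZ1, mul_one]
    have h := mul_le_mul_of_nonneg_left hZc hcoefZ
    linarith
  · rw [hsub, palinstrophy_transport (hfcd.of_le (by norm_cast)) (inv_pos.2 hl) b⁻¹, hPv, hP1, mul_one]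
    have h := mul_le_mul_of_nonneg_left hPc hcoefP
    linarith

end SeqCore

end NearSaturationNearMaximiser

end Summit.NavierStokesRegularity.NavierStokesRegularity.Theorems

end
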